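import Summits.CriticalPhenomena.PercolationContinuityZ3.Theorems.PercNearOneGluingNoHeavyLowerTailSahiGridPatternTheta

/-!
# `NoHeavyLowerTail` (crux stmt-CriticalPhenomena-4575), Sahi programme P1: **THE SIGN STRUCTURE OF THE y-PROFILE** of the pattern
# functional — every dimension

Support file (Sahi cell, seat `prim-sahi-p1`, generation 8; `--supports stmt-CriticalPhenomena-4575`).  Pure proofs; the only definition is
the bookkeeping `yProfile`; no `sorry`, standard axioms.

THE MATHEMATICS.  Summing the slice form (`sliceForm_eq`) over `q ∈ B` gives the y-PROFILE of the pattern functional,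
`P_y(A,B) := Σ_{q∈B} β_A(q,y) = [y∈B]·(2^{d+1}1_A(y) − ν_A(y)) − Σ_{q∈B} Θ_A(q,y)`, which does NOT depend on `C`, and
`sStarD A B C = Σ_{y∈C} P_y(A,B)` (`sStarD_eq_sum_yProfile`).  Using Θ-positivity (`…Theta`) and the chart of the Boolean cube around `y`:
* `yProfile_nonpos_of_not_mem`: `P_y(A,B) ≤ 0` whenever `y ∉ A ∩ B` (it is `−Σ_{q∈B}Θ_A(q,y) ≤ 0` off `B`, and `−ν_A(y) − Σ_qΘ ≤ 0` on `B∖A`);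
* `yProfile_nonneg_of_mem`: `P_y(A,B) ≥ 0` whenever `y ∈ A ∩ B` (there `P_y = (2^d − #(ℬ ∪ 𝒜ᶜˢ)) + (2^d − #(𝒜∩ℬ))` on the cube around `y`).
So, in every dimension, the y-profile is supported POSITIVELY EXACTLY ON THE UP-SET `A ∩ B` and negatively below/outside it, and
`PatternPos d` says precisely that, for all up-sets `A, B`, this profile lies in the dual cone of the up-sets ("the surplus on `A∩B` pays
the deficit in the transport order").  Immediate all-`d` consequences: `sStarD_nonneg_of_subset_inter` — `sStarD A B C ≥ 0` whenever
`C ⊆ A ∩ B` (a face of `PatternPos d` in every dimension).  Nothing conjectural is asserted. [this work]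
-/

namespace Summit.CriticalPhenomena.PercolationContinuityZ3.Theorems.SahiGridPattern

open Finset SahiGrid3
open scoped BigOperators FinsetFamily

variable {d : ℕ}

/-- **The y-profile** `P_y(A,B) = Σ_{q ∈ B} Σ_{p ∈ A} t_d(p,q,y)`. [this work] -/
def yProfile (A B : Finset (Pd d)) (y : Pd d) : ℤ := ∑ q ∈ B, ∑ p ∈ A, tcD p q y

/-- **y-decomposition**: `sStarD A B C = Σ_{y ∈ C} P_y(A,B)`. [this work] -/
theorem sStarD_eq_sum_yProfile (A B C : Finset (Pd d)) : sStarD A B C = ∑ y ∈ C, yProfile A B y := by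
  unfold yProfile
  rw [sStarD_eq_sum_tcD]
  have h : ∀ p ∈ A, (∑ q ∈ B, ∑ r ∈ C, tcD p q r) = ∑ r ∈ C, ∑ q ∈ B, tcD p q r := fun p _ => Finset.sum_comm
  rw [Finset.sum_congr rfl h, Finset.sum_comm]
  exact Finset.sum_congr rfl fun r _ => Finset.sum_comm

/-- The y-profile in closed form: `P_y(A,B) = [y∈B](2^{d+1}1_A(y) − ν_A(y)) − Σ_{q∈B} Θ_A(q,y)`. [this work] -/
theorem yProfile_eq (A B : Finset (Pd d)) (y : Pd d) :
    yProfile A B y = (if y ∈ B then 2 * (2 : ℤ) ^ d * ind A y - (nuCount A y : ℤ) else 0) - ∑ q ∈ B, thetaVal A q y := by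
  unfold yProfile
  have h : ∀ q ∈ B, (∑ p ∈ A, tcD p q y) =
      (if q = y then 2 * (2 : ℤ) ^ d * ind A q - (nuCount A q : ℤ) else 0) - thetaVal A q y := fun q _ => sliceForm_eq A q y
  rw [Finset.sum_congr rfl h, Finset.sum_sub_distrib, Finset.sum_ite_eq']

/-- `ν_A(y)` is the size of the trace family of `A` on the cube around `y`. [this work] -/
theorem nuCount_eq_card_fam (A : Finset (Pd d)) (y : Pd d) : (nuCount A y : ℤ) = ((fam y A).card : ℤ) := by
  classical
  have h1 : (nuCount A y : ℤ) = ∑ x ∈ univ.filter (fun x : Pd d => TotDist x y = true), ind A x := by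
    unfold nuCount
    rw [Finset.card_filter]
    push_cast
    rw [Finset.sum_filter, ← Finset.sum_ite_mem_eq A]
    refine Finset.sum_congr rfl fun x _ => ?_
    unfold ind
    by_cases hx : x ∈ A <;> by_cases ht : TotDist x y = true <;> simp [hx, ht]
  rw [h1, sum_totDist_eq_sum_sets]
  unfold ind
  rw [sum_ite_eq_card]
  rfl

/-- **The y-profile is nonpositive off `A ∩ B`** (every dimension). [this work] -/
theorem yProfile_nonpos_of_not_mem {A B : Finset (Pd d)} (hA : IsUpperSet (A : Set (Pd d))) (hB : IsUpperSet (B : Set (Pd d)))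
    {y : Pd d} (hy : y ∉ A ∩ B) : yProfile A B y ≤ 0 := by
  rw [yProfile_eq]
  have hθ := sum_thetaVal_col_nonneg hA hB y
  by_cases hyB : y ∈ B
  · have hyA : y ∉ A := fun h => hy (mem_inter.2 ⟨h, hyB⟩)
    have hind : ind A y = 0 := by unfold ind; rw [if_neg hyA]
    rw [if_pos hyB, hind]
    have : (0 : ℤ) ≤ (nuCount A y : ℤ) := by exact_mod_cast Nat.zero_le _
    linarith
  · rw [if_neg hyB]; linarith

/-- **The y-profile is nonnegative on `A ∩ B`** (every dimension). [this work] -/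
theorem yProfile_nonneg_of_mem {A B : Finset (Pd d)} {y : Pd d} (hy : y ∈ A ∩ B) : 0 ≤ yProfile A B y := by
  rw [yProfile_eq, sum_thetaVal_eq_card, nuCount_eq_card_fam]
  have hyA : y ∈ A := (mem_inter.1 hy).1
  have hyB : y ∈ B := (mem_inter.1 hy).2
  have hind : ind A y = 1 := by unfold ind; rw [if_pos hyA]
  rw [if_pos hyB, hind]
  -- cardinality facts on the Boolean cube `2^[d]`
  have htot : (Fintype.card (Finset (Fin d)) : ℤ) = (2 : ℤ) ^ d := by
    rw [Fintype.card_finset, Fintype.card_fin]; push_cast; ring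
  have h1 : ((fam y B ∩ fam y A).card : ℤ) ≤ (2 : ℤ) ^ d := by
    rw [← htot]; exact_mod_cast Finset.card_le_univ _
  have h2 : ((fam y B).card : ℤ) + ((fam y A).card : ℤ) - ((fam y B ∩ (fam y A)ᶜˢ).card : ℤ) ≤ (2 : ℤ) ^ d := by
    have hu : ((fam y B ∪ (fam y A)ᶜˢ).card : ℤ) ≤ (2 : ℤ) ^ d := by
      rw [← htot]; exact_mod_cast Finset.card_le_univ _
    have hie : ((fam y B ∪ (fam y A)ᶜˢ).card : ℤ) + ((fam y B ∩ (fam y A)ᶜˢ).card : ℤ) =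
        ((fam y B).card : ℤ) + (((fam y A)ᶜˢ).card : ℤ) := by exact_mod_cast Finset.card_union_add_card_inter _ _
    rw [card_compls] at hie
    linarith
  linarith

/-- **A face of `PatternPos d` in every dimension**: `sStarD A B C ≥ 0` whenever `C ⊆ A ∩ B`. [this work] -/
theorem sStarD_nonneg_of_subset_inter {A B C : Finset (Pd d)} (hC : C ⊆ A ∩ B) : 0 ≤ sStarD A B C := by
  rw [sStarD_eq_sum_yProfile]
  exact Finset.sum_nonneg fun y hy => yProfile_nonneg_of_mem (hC hy)

end Summit.CriticalPhenomena.PercolationContinuityZ3.Theorems.SahiGridPattern
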